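import Summits.QuantumAdvantage.QuantumAdvantage.Theses.SpinorFlattening
import Summits.QuantumAdvantage.QuantumAdvantage.Theorems.SpinorFlatteningNegApproxGaussRankSuperpoly
import Summits.QuantumAdvantage.QuantumAdvantage.Theorems.GaussRankPolyImpliesPPoly.Negative.RefutationShape

/-!
# Support item `SpinorFlattening.GaussRankPolyCollapse` (stmt-QuantumAdvantage-10445)

`GaussRankPolyCollapse := GaussRankPolyThesis → BQP ⊆ BPP` is the typed collapse antecedent of the
route's deciding theorem `closes : GaussRankPolyCollapse → GaussRankPolyThesis → ¬ QuantumAdvantage`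
(route `SpinorFlattening`, negation side on the free-fermion island).

## How it is settled
Exactly as the planner's docstring anticipated ("HONEST STATUS (i): provable ex falso once the kill
item lands"): the route's KILL item `NegApproxGaussRankSuperpoly` (stmt-QuantumAdvantage-1245: a
CONSTANT `δ ∈ (0,1)` — in fact `δ = 1/2` — at which the `δ`-approximate fermionic Gaussian rank of
the matchgate-magic powers `|M⟩^{⊗t}` is superpolynomial) is PROVED in the tree,
`Theorems.SpinorFlattening.NegApproxGaussRankSuperpoly_of`
(file `Theorems/SpinorFlatteningNegApproxGaussRankSuperpoly.lean`, spectral-mass flattening line),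
and it contradicts the route target `GaussRankPolyThesis` (polynomial `δ`-approximate Gaussian rank
for EVERY `δ > 0`) through the landed wiring lemma
`Theorems.GaussRankPolyImpliesPPoly.Negative.GaussRankPolyThesis_false_of_negApprox :
NegApproxGaussRankSuperpoly → ¬ GaussRankPolyThesis`
(file `Theorems/GaussRankPolyImpliesPPoly/Negative/RefutationShape.lean`; the two items share their
three inline `let`s verbatim, so the instantiation `δ ↦ c ↦ t ↦ (r, a, g)` type-checks
syntactically). The same composition is the tree's refutation of the target,
`Theorems.SpinorFlatteningGaussRankPolyThesis_refuted` (stmt-1244 closed `refuted`, route BROKEN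
since 2026-08-16T04:14Z). Hence the implication `GaussRankPolyCollapse` holds vacuously
(`GaussRankPolyCollapse_proof`); both ingredients are imported, nothing is re-declared.

## What this does NOT say
Nothing here simulates a quantum circuit: the honest, UNIFORM dequantization statement (P-uniform
finite Gaussian descriptions ⇒ `BQP ⊆ BPP`, DiasKoenig2024 / JozsaMiyake2008 / HebenstreitEtAl2019
packaging) is not typed on this route and is not needed — its hypothesis is now a theorem's negation.
With the target refuted, `closes` can only ever be applied ex falso; the route is expected to close
`refuted` (planner's kill criterion r2), and this file merely discharges the support hypothesis so
that the ledger records the item as settled rather than abandoned.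
-/

set_option linter.dupNamespace false -- D-0017: single-problem summit ⇒ `QuantumAdvantage.QuantumAdvantage` by design

namespace Summit.QuantumAdvantage.QuantumAdvantage.Theorems.SpinorFlattening

open Summit.QuantumAdvantage.QuantumAdvantage.Theses.SpinorFlattening

/-- **Item stmt-QuantumAdvantage-10445, settled**: `GaussRankPolyCollapse`, i.e.
`GaussRankPolyThesis → BQP ⊆ BPP`, holds — vacuously: its antecedent, the route target, is refuted
by the proved kill item `NegApproxGaussRankSuperpoly_of` through the wiring lemma
`GaussRankPolyThesis_false_of_negApprox` (the planner's anticipated outcome (i) for this support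
item; the same term as the tree's `SpinorFlatteningGaussRankPolyThesis_refuted`). Unconditional
(no named-fact hypotheses); the type is literally the route decl. -/
theorem GaussRankPolyCollapse_proof : GaussRankPolyCollapse :=
  fun hX => absurd hX
    (GaussRankPolyImpliesPPoly.Negative.GaussRankPolyThesis_false_of_negApprox
      NegApproxGaussRankSuperpoly_of)

end Summit.QuantumAdvantage.QuantumAdvantage.Theorems.SpinorFlattening
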